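import Literature.MathematicalPhysics.QuantumFieldTheory.Balaban1983to89.B4Eq19LatticeInteriorGradient
import HarnessLib

/-!
# Route `UnitScaleTilt`, crux K1 child «MinimiserStabilityRegPr» (stmt-QuantumFields-19200), registered stub `stub_prop7From14` (skeleton birth_v7
# cc37a178…; leaf V3 «Prop 7 from a background (14)») — THE FLAT INTERIOR GRADIENT ESTIMATE ON `ℤ^d` FOR BOUNDED (NON-DIVERGENCE) DATA, UNIFORM
# IN THE SCALE: `−Δu = f`, `|u| ≤ M_u`, `|f| ≤ F` on `Q_{4K}(a)` ⟹ `|∂_μu(a)| ≤ C_d(M_u∕K + K·F)` and `∂_μu` is `½`-Hölder at scale `K` with that constant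

Cell `ym3-torus` ∕ fleet seat `ym-ust-19200-p1` (gen 9; HUMAN RULING D-0037, YM ladder rung R3).  WHY.  The (4)-internal `ℓ²` route to clause 1 of
[Balaban1985Variational] Prop. 7 needs a representative of `W` rel. `U₀` that is both sup-small (`≤ cL^{−k}`) and `ℓ²`-good (CARD-19200-V3-g9 §6–7):
the blend (`Prop7BlendReduction`) of LOCAL COULOMB gauges, whose sup bound is, in the flat linear model, `|∇Δ⁻¹φ|_∞ ≤ C·L^k·|φ|_∞` — an interior
GRADIENT estimate for the lattice Poisson equation with merely BOUNDED data (estimate (s) of CARD §7).  The tree's [Giaquinta]-road (`B4Eq19Lattice*`)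
proves the `C^{1,½}` estimate for DIVERGENCE-FORM `½`-HÖLDER data (`B4Eq19LatticeInteriorGradient.exists_interior_gradient_const`); the antiderivative
of a bounded `f` is not transversally Hölder, so the bounded-data case is not a corollary of that statement — but it IS a corollary of the same road:
the Dirichlet corrector with data `∂*G`, `G` the box antiderivative of `f`, has energy `≤ 75·5^d·d·K·F²·(r+1)^{d+1}` (`r ≤ 2K`), the junk term of the
gradient Campanato iteration with exponent `d + 1`, i.e. `H` replaced by `K·F`.  THIS FILE runs that road at `κ = 0`.

WHAT IS PROVED (sorry-free; no definition; [folklore] discrete elliptic regularity, [Giaquinta1984] Ch. III §2–3).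
* `exists_data_antideriv` — on `Q_{r+2}(x)`, `0 ≤ r ≤ 2K`, `K ≥ 3`: `f = ∂*G` with `Σ_{Q_{r+2}} Σ_ν G² ≤ 75·5^d·d·K·F²·(r+1)^{d+1}`.
* **`gradient_campanato_step_bounded`** — `−Δu = f`, `|f| ≤ F` on `Q_{4K}(a)`, `x ∈ Q_K(a)`, `0 ≤ ρ ≤ r ≤ 2K`:
  `exc (∂_μu)(Q_ρ(x)) ≤ 4A₁((ρ+1)∕(r+1))^{d+2} exc (∂_μu)(Q_r(x)) + (4A₁+2)·75·5^d·d·K·F²·(r+1)^{d+1}` (`A₁` of `gradient_excess_decay`).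
* `top_scale_bound_zero` — `gradSq u (Q_{2K}(x)) ≤ (126·7^d + 648·6^d)·d·K^{d+1}·E`, `E = ((M_u∕K)² + (KF)²)∕K` (massive rewriting + `top_scale_bound`).
* **`exists_gradient_campanato_const_bounded`** — `∃ C_d`: `exc (∂_μu)(Q_ρ(x)) ≤ C_d·E·(ρ+1)^{d+1}` for `x ∈ Q_K(a)`, `0 ≤ ρ ≤ 2K`.
* **`exists_interior_gradient_const_bounded`** — `∃ C_d`: `|∂_μu(a)| ≤ C_d(M_u∕K + KF)` and `|∂_μu(x′) − ∂_μu(a)| ≤ C_d(M_u∕K + KF)√(ρ₀∕K)` for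
  `x′ ∈ Q_{ρ₀}(a)`, `1 ≤ ρ₀ ≤ K`.

HONEST SCOPE.  [folklore] lattice analysis with crude constants; the flat, linear, scalar core of estimate (s) only (the local Coulomb gauge itself, its
Hodge gap (a), the cocycle constants (c) and the nonabelian perturbation layer are open, CARD §7); count-neutral helper toward stmt-QuantumFields-19200
(`--supports`); no statement of [Balaban1985Variational] or [Balaban1984PropagatorsII] is proved.

References: M. Giaquinta, *Multiple integrals in the calculus of variations and nonlinear elliptic systems*, Princeton UP 1983 [Giaquinta1984] (Ch. III
§2–3); T. Bałaban, CMP 96 (1984) 223–250 [Balaban1984PropagatorsII] ((1.9) p.226); CMP 102 (1985) 277–309 [Balaban1985Variational] (Prop. 7 p.299).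
-/

noncomputable section

open scoped BigOperators
open Finset

namespace Summit.QuantumFields.YangMills.Theorems.Prop7FlatInteriorGradient

open Literature.MathematicalPhysics.QuantumFieldTheory.Balaban1983to89
open B4Eq19LatticeOperators B4Eq19LatticeCaccioppoli B4Eq19LatticeDirichletReplacement B4Eq19LatticeBoxMeans B4Eq19LatticeDirichletZero
  B4Eq19LatticeGradientExcessDecay B4Eq19CampanatoIterationSharp B4Eq19LatticeInteriorHolder B4Eq19LatticeGradientCampanato
  B4Eq19LatticeInteriorGradient

variable {d : ℕ}

/-! ## §1 The data term -/

/-- **The box antiderivative of bounded data and its energy**: for `|f| ≤ F` on `Q_{r+2}(x)`, `0 ≤ r ≤ 2K`, `K ≥ 3`, there is `G` with `∂*G = f` on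
`Q_{r+2}(x)` and `Σ_{Q_{r+2}(x)} Σ_ν G² ≤ 75·5^d·d·K·F²·(r+1)^{d+1}` (`|G| ≤ (2r+5)F`, `(2r+5)^{d+2} ≤ 5^d(r+1)^d·75K(r+1)`). [folklore]
[cite: Giaquinta1984, Ch. III §3 p.85] -/
theorem exists_data_antideriv (hd : 0 < d) {K : ℕ} (hK : 3 ≤ K) (f : Zd d → ℝ) (x : Zd d) {F : ℝ} {r : ℤ} (hr0 : 0 ≤ r) (hr : r ≤ 2 * K)
    (hf : ∀ y ∈ box x (r + 2), |f y| ≤ F) :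
    ∃ G : Zd d → Fin d → ℝ, (∀ y ∈ box x (r + 2), dvg G y = f y) ∧
      ∑ y ∈ box x (r + 2), ∑ ν, G y ν ^ 2 ≤ 75 * 5 ^ d * d * K * F ^ 2 * ((r : ℝ) + 1) ^ (d + 1) := by
  obtain ⟨G, hGeq, hGle⟩ := exists_antideriv hd f x (r + 2) hf
  refine ⟨G, hGeq, ?_⟩
  have hK3 : (3 : ℝ) ≤ K := by exact_mod_cast hK
  have hrR : (0 : ℝ) ≤ r := by exact_mod_cast hr0
  have hr2K : (r : ℝ) ≤ 2 * K := by exact_mod_cast hr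
  have hdR : (0 : ℝ) ≤ d := Nat.cast_nonneg d
  have hF2 : 0 ≤ F ^ 2 := sq_nonneg F
  have hsum := sum_sq_le_of_bound (z := x) (s := r + 2) (by linarith) G hGle
  have e1 : ((2 * (r + 2) + 1 : ℤ) : ℝ) = 2 * (r : ℝ) + 5 := by push_cast; ring
  rw [e1] at hsum
  have i1 : (2 * (r : ℝ) + 5) ^ d ≤ 5 ^ d * ((r : ℝ) + 1) ^ d := by
    rw [← mul_pow]; exact pow_le_pow_left₀ (by linarith) (by linarith) d
  have i2 : ((2 * (r : ℝ) + 5) * F) ^ 2 ≤ 75 * K * ((r : ℝ) + 1) * F ^ 2 := by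
    rw [mul_pow]
    apply mul_le_mul_of_nonneg_right _ hF2
    nlinarith
  calc ∑ y ∈ box x (r + 2), ∑ ν, G y ν ^ 2 ≤ d * (2 * (r : ℝ) + 5) ^ d * ((2 * (r : ℝ) + 5) * F) ^ 2 := by
        refine hsum.trans (le_of_eq ?_); push_cast; ring
    _ ≤ d * (5 ^ d * ((r : ℝ) + 1) ^ d) * (75 * K * ((r : ℝ) + 1) * F ^ 2) :=
        mul_le_mul (mul_le_mul_of_nonneg_left i1 hdR) i2 (by positivity) (by positivity)
    _ = 75 * 5 ^ d * d * K * F ^ 2 * ((r : ℝ) + 1) ^ (d + 1) := by ring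

/-! ## §2 The comparison step at `κ = 0` with bounded data -/

/-- **THE COMPARISON STEP OF THE GRADIENT CAMPANATO ITERATION, BOUNDED DATA.**  `d ≥ 1`, `K ≥ 3`, `−Δu = f` and `|f| ≤ F` on `Q_{4K}(a)`.  For
`x ∈ Q_K(a)`, `0 ≤ ρ ≤ r ≤ 2K` and every `μ`:
`exc (∂_μu)(Q_ρ(x)) ≤ 4A₁((ρ+1)∕(r+1))^{d+2}·exc (∂_μu)(Q_r(x)) + (4A₁+2)·75·5^d·d·K·F²·(r+1)^{d+1}` (massless harmonic replacement on `Q_{r+1}(x)` with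
data `∂*G`, `G` the box antiderivative of `f`; `gradient_excess_decay` for the harmonic part). [folklore]
[cite: Giaquinta1984, Ch. III §3 Thm 3.1–3.2 pp.84–88] -/
theorem gradient_campanato_step_bounded (hd : 1 ≤ d) {K : ℕ} (hK : 3 ≤ K) (u f : Zd d → ℝ) (a : Zd d) {F : ℝ}
    (hEq : ∀ y ∈ box a (4 * K), lop 0 u y = f y) (hf : ∀ y ∈ box a (4 * K), |f y| ≤ F)
    {x : Zd d} (hx : x ∈ box a K) (μ : Fin d) {ρ r : ℤ} (hρ : 0 ≤ ρ) (hρr : ρ ≤ r) (hr : r ≤ 2 * K) :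
    exc (fdiff μ u) x ρ ≤
      4 * ((4 : ℝ) ^ d * d ^ 2 * (1 + 56 * d) ^ d * ((2 : ℝ) ^ d * (1 + 56 * d) ^ d * (8 * ((d : ℝ) + 1)) ^ (d + 1)) *
          (896 * d * (12 * (d : ℝ) + 8) ^ d) + (12 * (d : ℝ) + 8) ^ (d + 2)) * (((ρ : ℝ) + 1) / ((r : ℝ) + 1)) ^ (d + 2) * exc (fdiff μ u) x r +
      (4 * ((4 : ℝ) ^ d * d ^ 2 * (1 + 56 * d) ^ d * ((2 : ℝ) ^ d * (1 + 56 * d) ^ d * (8 * ((d : ℝ) + 1)) ^ (d + 1)) *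
          (896 * d * (12 * (d : ℝ) + 8) ^ d) + (12 * (d : ℝ) + 8) ^ (d + 2)) + 2) *
        (75 * 5 ^ d * d * K * F ^ 2 * ((r : ℝ) + 1) ^ (d + 1)) := by
  set A₁ : ℝ := (4 : ℝ) ^ d * d ^ 2 * (1 + 56 * d) ^ d * ((2 : ℝ) ^ d * (1 + 56 * d) ^ d * (8 * ((d : ℝ) + 1)) ^ (d + 1)) *
          (896 * d * (12 * (d : ℝ) + 8) ^ d) + (12 * (d : ℝ) + 8) ^ (d + 2) with hA₁
  have hd0 : 0 < d := by omega
  have hA₁0 : 0 ≤ A₁ := by positivity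
  have hK3 : (3 : ℝ) ≤ K := by exact_mod_cast hK
  have hKZ : (3 : ℤ) ≤ K := by exact_mod_cast hK
  have hr0 : 0 ≤ r := hρ.trans hρr
  have hρR : (0 : ℝ) ≤ ρ := by exact_mod_cast hρ
  have hrR : (ρ : ℝ) ≤ r := by exact_mod_cast hρr
  have hr1 : (0 : ℝ) < (r : ℝ) + 1 := by linarith
  have hsub : box x (r + 2) ⊆ box a (4 * K) := box_subset_box fun i => by have := (mem_box.1 hx) i; linarith
  obtain ⟨G, hGeq, hGE⟩ := exists_data_antideriv hd0 hK f x hr0 hr (fun y hy => hf y (hsub hy))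
  set W : ℝ := 75 * 5 ^ d * d * K * F ^ 2 * ((r : ℝ) + 1) ^ (d + 1) with hW
  have hW0 : 0 ≤ W := by positivity
  have hEq0 : ∀ y ∈ box x (r + 2), lop 0 u y = dvg G y := fun y hy => by rw [hEq y (hsub hy), hGeq y hy]
  obtain ⟨h, w, huhw, -, hh, hwE⟩ := exists_harmonic_replacement_zero hd0 u G x (r + 1) (fun y hy => hEq0 y (box_mono x (by linarith) hy))
  have hwE' : ∀ Q : Finset (Zd d), gradSq w Q ≤ W := fun Q =>
    (hwE Q).trans (le_of_eq_of_le (by rw [show r + 1 + 1 = r + 2 by ring]) hGE)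
  have hfd : ∀ y, fdiff μ u y = fdiff μ h y + fdiff μ w y := fun y => by
    simp only [fdiff_apply, huhw]; ring
  have hfd' : ∀ y, fdiff μ h y = fdiff μ u y + (-(fdiff μ w y)) := fun y => by rw [hfd y]; ring
  have hexcw : ∀ s : ℤ, exc (fdiff μ w) x s ≤ W := fun s =>
    (exc_le_sum_sq _ x s).trans ((sum_sq_fdiff_le_gradSq w _ μ).trans (hwE' _))
  have hexcw' : ∀ s : ℤ, exc (fun y => -(fdiff μ w y)) x s ≤ W := fun s =>
    (exc_le_sum_sq _ x s).trans (le_trans (by simp only [neg_sq]; exact le_rfl) ((sum_sq_fdiff_le_gradSq w _ μ).trans (hwE' _)))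
  have hq0 : 0 ≤ ((ρ : ℝ) + 1) / ((r : ℝ) + 1) := by positivity
  have hq1 : (((ρ : ℝ) + 1) / ((r : ℝ) + 1)) ^ (d + 2) ≤ 1 := pow_le_one₀ hq0 (by rw [div_le_one hr1]; linarith)
  have hdec := gradient_excess_decay hρ hρr h hh μ
  rw [← hA₁] at hdec
  have e_u : exc (fdiff μ u) x ρ = exc (fun y => fdiff μ h y + fdiff μ w y) x ρ := by
    congr 1; funext y; exact hfd y
  have e_h : exc (fdiff μ h) x r = exc (fun y => fdiff μ u y + (-(fdiff μ w y))) x r := by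
    congr 1; funext y; exact hfd' y
  have hexc_h_r : exc (fdiff μ h) x r ≤ 2 * exc (fdiff μ u) x r + 2 * W := by
    rw [e_h]; exact (exc_add_le _ _ x r).trans (by linarith [hexcw' r])
  have hexc_u_ρ : exc (fdiff μ u) x ρ ≤ 2 * exc (fdiff μ h) x ρ + 2 * W := by
    rw [e_u]; exact (exc_add_le _ _ x ρ).trans (by linarith [hexcw ρ])
  have hexcur : 0 ≤ exc (fdiff μ u) x r := exc_nonneg _ _ _
  calc exc (fdiff μ u) x ρ ≤ 2 * exc (fdiff μ h) x ρ + 2 * W := hexc_u_ρ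
    _ ≤ 2 * (A₁ * (((ρ : ℝ) + 1) / ((r : ℝ) + 1)) ^ (d + 2) * exc (fdiff μ h) x r) + 2 * W := by linarith [hdec]
    _ ≤ 2 * (A₁ * (((ρ : ℝ) + 1) / ((r : ℝ) + 1)) ^ (d + 2) * (2 * exc (fdiff μ u) x r + 2 * W)) + 2 * W := by
        have := mul_le_mul_of_nonneg_left hexc_h_r (by positivity : (0 : ℝ) ≤ A₁ * (((ρ : ℝ) + 1) / ((r : ℝ) + 1)) ^ (d + 2))
        linarith
    _ = 4 * A₁ * (((ρ : ℝ) + 1) / ((r : ℝ) + 1)) ^ (d + 2) * exc (fdiff μ u) x r +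
          (4 * A₁ * (((ρ : ℝ) + 1) / ((r : ℝ) + 1)) ^ (d + 2) + 2) * W := by ring
    _ ≤ 4 * A₁ * (((ρ : ℝ) + 1) / ((r : ℝ) + 1)) ^ (d + 2) * exc (fdiff μ u) x r + (4 * A₁ + 2) * W := by
        have : 4 * A₁ * (((ρ : ℝ) + 1) / ((r : ℝ) + 1)) ^ (d + 2) ≤ 4 * A₁ := by
          have := mul_le_mul_of_nonneg_left hq1 (by positivity : (0:ℝ) ≤ 4 * A₁); linarith
        have := mul_le_mul_of_nonneg_right (add_le_add_right this 2) hW0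
        linarith

/-! ## §3 The top scale -/

/-- **The top scale at `κ = 0`**: for `K ≥ 3`, `x ∈ Q_K(a)`, `−Δu = f`, `|u| ≤ M_u`, `|f| ≤ F` on `Q_{4K}(a)`:
`gradSq u (Q_{2K}(x)) ≤ (126·7^d + 648·6^d)·d·K^{d+1}·((M_u∕K)² + (KF)²)∕K` (the massive rewriting `(−Δ+K⁻²)u = ∂*G`, `G` the antiderivative of
`f + K⁻²u` on `Q_{4K}(a)`, `|G| ≤ (8K+1)(F + M_u∕K²)`, and `top_scale_bound`). [folklore] [cite: Giaquinta1984, Ch. III §2 (2.4) p.77] -/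
theorem top_scale_bound_zero (hd : 1 ≤ d) {K : ℕ} (hK : 3 ≤ K) (u f : Zd d → ℝ) (a : Zd d) {Mu F : ℝ}
    (hEq : ∀ y ∈ box a (4 * K), lop 0 u y = f y) (hu : ∀ y ∈ box a (4 * K), |u y| ≤ Mu) (hf : ∀ y ∈ box a (4 * K), |f y| ≤ F)
    {x : Zd d} (hx : x ∈ box a K) :
    gradSq u (box x (2 * K)) ≤ (126 * 7 ^ d + 648 * 6 ^ d) * d * ((K : ℝ) ^ (d + 1) * (((Mu / K) ^ 2 + (K * F) ^ 2) / K)) := by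
  have hd0 : 0 < d := by omega
  have hdR : (0 : ℝ) ≤ d := Nat.cast_nonneg d
  have hK3 : (3 : ℝ) ≤ K := by exact_mod_cast hK
  have hK0 : (0 : ℝ) < K := by linarith
  have hf₁ : ∀ y ∈ box a (4 * K), |f y + 1 / (K : ℝ) ^ 2 * u y| ≤ F + Mu / (K : ℝ) ^ 2 := by
    intro y hy
    have h1 := hf y hy
    have h2 := hu y hy
    have h3 : |1 / (K : ℝ) ^ 2 * u y| ≤ Mu / (K : ℝ) ^ 2 := by
      rw [abs_mul, abs_of_pos (by positivity : (0 : ℝ) < 1 / (K : ℝ) ^ 2)]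
      calc 1 / (K : ℝ) ^ 2 * |u y| ≤ 1 / (K : ℝ) ^ 2 * Mu := mul_le_mul_of_nonneg_left h2 (by positivity)
        _ = Mu / (K : ℝ) ^ 2 := by ring
    exact (abs_add_le _ _).trans (add_le_add h1 h3)
  obtain ⟨G, hGeq, hGle⟩ := exists_antideriv hd0 (fun y => f y + 1 / (K : ℝ) ^ 2 * u y) a (4 * K) hf₁
  have hEq' : ∀ y ∈ box a (4 * K), lop (1 / (K : ℝ) ^ 2) u y = dvg G y := by
    intro y hy
    rw [hGeq y hy, ← hEq y hy, lop_zero_eq_sub (1 / (K : ℝ) ^ 2)]; ring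
  have hGle' : ∀ y ∈ box a (4 * K), ∀ ν, |G y ν| ≤ (2 * (4 * (K : ℝ)) + 1) * (F + Mu / (K : ℝ) ^ 2) := by
    intro y hy ν; have := hGle y hy ν; push_cast at this; exact this
  have hTop := top_scale_bound hK u G a hEq' hu hGle' hx
  refine hTop.trans ?_
  have hm : ((K : ℝ) * ((2 * (4 * (K : ℝ)) + 1) * (F + Mu / (K : ℝ) ^ 2))) ^ 2 ≤ 162 * ((K : ℝ) ^ 4 * F ^ 2 + Mu ^ 2) := by
    have e : (K : ℝ) * ((2 * (4 * (K : ℝ)) + 1) * (F + Mu / (K : ℝ) ^ 2)) = (8 * K + 1) / K * ((K : ℝ) ^ 2 * F + Mu) := by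
      field_simp; ring
    rw [e, mul_pow]
    have h9 : ((8 * (K : ℝ) + 1) / K) ^ 2 ≤ 81 := by
      rw [div_pow, div_le_iff₀ (by positivity)]; nlinarith
    have hsq : ((K : ℝ) ^ 2 * F + Mu) ^ 2 ≤ 2 * ((K : ℝ) ^ 4 * F ^ 2 + Mu ^ 2) := by
      nlinarith [sq_nonneg ((K : ℝ) ^ 2 * F - Mu)]
    calc ((8 * (K : ℝ) + 1) / K) ^ 2 * ((K : ℝ) ^ 2 * F + Mu) ^ 2 ≤ 81 * (2 * ((K : ℝ) ^ 4 * F ^ 2 + Mu ^ 2)) :=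
          mul_le_mul h9 hsq (by positivity) (by norm_num)
      _ = 162 * ((K : ℝ) ^ 4 * F ^ 2 + Mu ^ 2) := by ring
  have e1 : (K : ℝ) ^ (d + 1) * (((Mu / K) ^ 2 + (K * F) ^ 2) / K) = (K : ℝ) ^ d / (K : ℝ) ^ 2 * ((K : ℝ) ^ 4 * F ^ 2 + Mu ^ 2) := by
    field_simp; ring
  rw [e1]
  have hX : 0 ≤ (K : ℝ) ^ d / (K : ℝ) ^ 2 := by positivity
  have hMuK : Mu ^ 2 ≤ (K : ℝ) ^ 4 * F ^ 2 + Mu ^ 2 := by nlinarith [sq_nonneg F]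
  calc (126 * d * 7 ^ d) * ((K : ℝ) ^ d / (K : ℝ) ^ 2) * Mu ^ 2 +
        (4 * d * 6 ^ d) * ((K : ℝ) ^ d / (K : ℝ) ^ 2) * ((K : ℝ) * ((2 * (4 * (K : ℝ)) + 1) * (F + Mu / (K : ℝ) ^ 2))) ^ 2
      ≤ (126 * d * 7 ^ d) * ((K : ℝ) ^ d / (K : ℝ) ^ 2) * ((K : ℝ) ^ 4 * F ^ 2 + Mu ^ 2) +
        (4 * d * 6 ^ d) * ((K : ℝ) ^ d / (K : ℝ) ^ 2) * (162 * ((K : ℝ) ^ 4 * F ^ 2 + Mu ^ 2)) :=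
        add_le_add (mul_le_mul_of_nonneg_left hMuK (by positivity)) (mul_le_mul_of_nonneg_left hm (by positivity))
    _ = (126 * 7 ^ d + 648 * 6 ^ d) * d * ((K : ℝ) ^ d / (K : ℝ) ^ 2 * ((K : ℝ) ^ 4 * F ^ 2 + Mu ^ 2)) := by ring

/-! ## §4 The gradient Campanato estimate -/

/-- **THE GRADIENT CAMPANATO ESTIMATE ON `ℤ^d` FOR BOUNDED DATA, UNIFORM IN THE SCALE.**  There is `C_d ≥ 0` such that for every `K ≥ 3`, every `u, f`
with `−Δu = f`, `|u| ≤ M_u`, `|f| ≤ F` on `Q_{4K}(a)`, every centre `x ∈ Q_K(a)`, direction `μ` and `0 ≤ ρ ≤ 2K`: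
`exc (∂_μu)(Q_ρ(x)) ≤ C_d·(((M_u∕K)² + (KF)²)∕K)·(ρ+1)^{d+1}` (`gradient_campanato_step_bounded` ⇒ `exc_campanato_hypothesis` ⇒ `campanato_iteration_sharp`
with `q = d+1`; top scale by `top_scale_bound_zero`). [folklore] [cite: Giaquinta1984, Ch. III §3 Thm 3.1–3.2 pp.84–88, §1 Thm 1.2 p.70] -/
theorem exists_gradient_campanato_const_bounded (d : ℕ) (hd : 1 ≤ d) : ∃ C : ℝ, 0 ≤ C ∧
    ∀ (K : ℕ), 3 ≤ K → ∀ (u f : Zd d → ℝ) (a : Zd d) (Mu F : ℝ), 0 ≤ Mu → 0 ≤ F →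
      (∀ y ∈ box a (4 * K), lop 0 u y = f y) → (∀ y ∈ box a (4 * K), |u y| ≤ Mu) → (∀ y ∈ box a (4 * K), |f y| ≤ F) →
      ∀ x ∈ box a (K : ℤ), ∀ (μ : Fin d) (ρ : ℤ), 0 ≤ ρ → ρ ≤ 2 * K →
        exc (fdiff μ u) x ρ ≤ C * (((Mu / K) ^ 2 + (K * F) ^ 2) / K) * ((ρ : ℝ) + 1) ^ (d + 1) := by
  set A₁ : ℝ := (4 : ℝ) ^ d * d ^ 2 * (1 + 56 * d) ^ d * ((2 : ℝ) ^ d * (1 + 56 * d) ^ d * (8 * ((d : ℝ) + 1)) ^ (d + 1)) *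
          (896 * d * (12 * (d : ℝ) + 8) ^ d) + (12 * (d : ℝ) + 8) ^ (d + 2) with hA₁
  have hdR : (0 : ℝ) ≤ d := Nat.cast_nonneg d
  have hA₁0 : 0 ≤ A₁ := by positivity
  have hA₁1 : 1 ≤ A₁ := by
    rw [hA₁]
    have h1 : (1 : ℝ) ≤ (12 * (d : ℝ) + 8) ^ (d + 2) := one_le_pow₀ (by linarith)
    have h2 : (0 : ℝ) ≤ (4 : ℝ) ^ d * d ^ 2 * (1 + 56 * d) ^ d * ((2 : ℝ) ^ d * (1 + 56 * d) ^ d * (8 * ((d : ℝ) + 1)) ^ (d + 1)) *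
          (896 * d * (12 * (d : ℝ) + 8) ^ d) := by positivity
    linarith
  set A : ℝ := 4 * 2 ^ (d + 2) * A₁ with hA
  have hA1 : 1 ≤ A := by
    rw [hA]; exact one_le_mul_of_one_le_of_one_le (one_le_mul_of_one_le_of_one_le (by norm_num) (one_le_pow₀ (by norm_num))) hA₁1
  set D₀ : ℝ := (4 * A₁ + 2) * (75 * 5 ^ d * d) with hD₀
  have hD₀0 : 0 ≤ D₀ := by positivity
  set Ct : ℝ := (126 * 7 ^ d + 648 * 6 ^ d) * d with hCt
  have hCt0 : 0 ≤ Ct := by positivity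
  set C : ℝ := (4 * A) ^ (d + 1) * Ct + 4 / 3 * (4 * A) ^ (2 * (d + 1)) * D₀ with hC
  refine ⟨C, by positivity, ?_⟩
  intro K hK u f a Mu F hMu hF hEq hu hf x hx μ ρ hρ hρK
  have hK3 : (3 : ℝ) ≤ K := by exact_mod_cast hK
  have hK0 : (0 : ℝ) < K := by linarith
  set E : ℝ := ((Mu / K) ^ 2 + (K * F) ^ 2) / K with hE
  have hE0 : 0 ≤ E := by positivity
  set B : ℝ := D₀ * E with hB
  have hB0 : 0 ≤ B := by positivity
  have hKF : (K : ℝ) * F ^ 2 ≤ E := by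
    rw [hE, le_div_iff₀ hK0]
    nlinarith [sq_nonneg (Mu / K), sq_nonneg F, hK0]
  have hstep : ∀ ρ' r : ℤ, 0 ≤ ρ' → ρ' ≤ r → r ≤ 2 * K →
      exc (fdiff μ u) x ρ' ≤ 4 * A₁ * (((ρ' : ℝ) + 1) / ((r : ℝ) + 1)) ^ (d + 2) * exc (fdiff μ u) x r + B * ((r : ℝ) + 1) ^ (d + 1) := by
    intro ρ' r h1 h2 h3
    have h := gradient_campanato_step_bounded hd hK u f a hEq hf hx μ h1 h2 h3
    rw [← hA₁] at h
    have hr1 : (0 : ℝ) ≤ ((r : ℝ) + 1) ^ (d + 1) := by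
      apply pow_nonneg; have : (0 : ℝ) ≤ r := by exact_mod_cast h1.trans h2
      linarith
    have hjunk : (4 * A₁ + 2) * (75 * 5 ^ d * d * K * F ^ 2 * ((r : ℝ) + 1) ^ (d + 1)) ≤ B * ((r : ℝ) + 1) ^ (d + 1) := by
      rw [hB, hD₀]
      have e : (4 * A₁ + 2) * (75 * 5 ^ d * d * K * F ^ 2 * ((r : ℝ) + 1) ^ (d + 1)) =
          (4 * A₁ + 2) * (75 * 5 ^ d * d) * ((K : ℝ) * F ^ 2) * ((r : ℝ) + 1) ^ (d + 1) := by ring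
      rw [e]
      exact mul_le_mul_of_nonneg_right (mul_le_mul_of_nonneg_left hKF (by positivity)) hr1
    linarith
  have hiter := campanato_iteration_sharp (ψ := fun t => exc (fdiff μ u) x (⌊t⌋ - 1)) (R₀ := 2 * (K : ℝ) + 1) (q := d + 1) hA1 hB0
    (fun t _ _ => exc_nonneg _ _ _) (fun s t _ hst _ => exc_mono _ x (by linarith [Int.floor_le_floor hst]))
    (by
      intro P R hP hPR hR
      have := exc_campanato_hypothesis (fdiff μ u) x hA₁0 hB0 hstep P R hP hPR hR
      rw [← hA] at this
      exact this)
  have hρR : (0 : ℝ) ≤ ρ := by exact_mod_cast hρ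
  have hρKR : (ρ : ℝ) ≤ 2 * K := by exact_mod_cast hρK
  have hmain := hiter ((ρ : ℝ) + 1) (2 * (K : ℝ) + 1) (by linarith) (by linarith) le_rfl
  have eP : ⌊(ρ : ℝ) + 1⌋ - 1 = ρ := by
    rw [show (ρ : ℝ) + 1 = ((ρ + 1 : ℤ) : ℝ) by push_cast; ring, Int.floor_intCast]; ring
  have eR : ⌊2 * (K : ℝ) + 1⌋ - 1 = 2 * (K : ℤ) := by
    rw [show 2 * (K : ℝ) + 1 = ((2 * (K : ℤ) + 1 : ℤ) : ℝ) by push_cast; ring, Int.floor_intCast]; ring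
  simp only [eP, eR] at hmain
  have htop : exc (fdiff μ u) x (2 * K) ≤ Ct * ((K : ℝ) ^ (d + 1) * E) := by
    have h1 : exc (fdiff μ u) x (2 * K) ≤ gradSq u (box x (2 * K)) :=
      (exc_le_sum_sq _ x _).trans (sum_sq_fdiff_le_gradSq u _ μ)
    have h2 := top_scale_bound_zero hd hK u f a hEq hu hf hx
    rw [← hCt, ← hE] at h2
    exact h1.trans h2
  have hscale : (((ρ : ℝ) + 1) / (2 * (K : ℝ) + 1)) ^ (d + 1) * (K : ℝ) ^ (d + 1) ≤ ((ρ : ℝ) + 1) ^ (d + 1) := by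
    rw [div_pow, div_mul_eq_mul_div, div_le_iff₀ (by positivity)]
    exact mul_le_mul_of_nonneg_left (pow_le_pow_left₀ hK0.le (by linarith) _) (by positivity)
  have hP0 : 0 ≤ ((ρ : ℝ) + 1) ^ (d + 1) := by positivity
  calc exc (fdiff μ u) x ρ
      ≤ (4 * A) ^ (d + 1) * (((ρ : ℝ) + 1) / (2 * (K : ℝ) + 1)) ^ (d + 1) * exc (fdiff μ u) x (2 * K) +
          4 / 3 * (4 * A) ^ (2 * (d + 1)) * B * ((ρ : ℝ) + 1) ^ (d + 1) := hmain
    _ ≤ (4 * A) ^ (d + 1) * (((ρ : ℝ) + 1) / (2 * (K : ℝ) + 1)) ^ (d + 1) * (Ct * ((K : ℝ) ^ (d + 1) * E)) +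
          4 / 3 * (4 * A) ^ (2 * (d + 1)) * B * ((ρ : ℝ) + 1) ^ (d + 1) := by
        have := mul_le_mul_of_nonneg_left htop (by positivity : (0:ℝ) ≤ (4 * A) ^ (d + 1) * (((ρ : ℝ) + 1) / (2 * (K : ℝ) + 1)) ^ (d + 1))
        linarith
    _ = (4 * A) ^ (d + 1) * Ct * E * ((((ρ : ℝ) + 1) / (2 * (K : ℝ) + 1)) ^ (d + 1) * (K : ℝ) ^ (d + 1)) +
          4 / 3 * (4 * A) ^ (2 * (d + 1)) * D₀ * E * ((ρ : ℝ) + 1) ^ (d + 1) := by rw [hB]; ring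
    _ ≤ (4 * A) ^ (d + 1) * Ct * E * ((ρ : ℝ) + 1) ^ (d + 1) +
          4 / 3 * (4 * A) ^ (2 * (d + 1)) * D₀ * E * ((ρ : ℝ) + 1) ^ (d + 1) := by
        have := mul_le_mul_of_nonneg_left hscale (by positivity : (0:ℝ) ≤ (4 * A) ^ (d + 1) * Ct * E)
        linarith
    _ = C * E * ((ρ : ℝ) + 1) ^ (d + 1) := by rw [hC]; ring

/-! ## §5 The interior gradient estimate -/

/-- **THE INTERIOR GRADIENT (`C^{1,½}`) ESTIMATE ON `ℤ^d` FOR BOUNDED DATA, UNIFORM IN THE SCALE.**  There is `C_d ≥ 0` such that for every `K ≥ 3` and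
every `u, f` with `−Δu = f`, `|u| ≤ M_u`, `|f| ≤ F` on `Q_{4K}(a)`: `|∂_μu(a)| ≤ C_d(M_u∕K + K·F)` and `|∂_μu(x′) − ∂_μu(a)| ≤ C_d(M_u∕K + K·F)√(ρ₀∕K)` for
`x′ ∈ Q_{ρ₀}(a)`, `1 ≤ ρ₀ ≤ K`.  In η-units (`η = K⁻¹`, `Δ^η = K²Δ`, `∇^η = K∂`): `‖∇^η(Δ^η)⁻¹f‖_∞ ≲ ‖u‖_∞ + ‖f‖_∞` — the flat, linear core of the sup
bound of a local Coulomb potential at scale `L^k` (CARD-19200-V3-g9 §7 (s)). [folklore]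
[cite: Giaquinta1984, Ch. III §3 Thm 3.1–3.2 pp.84–88, §1 Thm 1.2 pp.70–72; Balaban1984PropagatorsII, (1.9) p.226] -/
theorem exists_interior_gradient_const_bounded (d : ℕ) (hd : 1 ≤ d) : ∃ C : ℝ, 0 ≤ C ∧
    ∀ (K : ℕ), 3 ≤ K → ∀ (u f : Zd d → ℝ) (a : Zd d) (Mu F : ℝ), 0 ≤ Mu → 0 ≤ F →
      (∀ y ∈ box a (4 * K), lop 0 u y = f y) → (∀ y ∈ box a (4 * K), |u y| ≤ Mu) → (∀ y ∈ box a (4 * K), |f y| ≤ F) →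
      ∀ μ : Fin d, |fdiff μ u a| ≤ C * (Mu / K + K * F) ∧
        ∀ (x' : Zd d) (ρ₀ : ℕ), 1 ≤ ρ₀ → ρ₀ ≤ K → x' ∈ box a (ρ₀ : ℤ) →
          |fdiff μ u x' - fdiff μ u a| ≤ C * (Mu / K + K * F) * Real.sqrt ((ρ₀ : ℝ) / K) := by
  obtain ⟨C₂, hC₂0, hC₂⟩ := exists_gradient_campanato_const_bounded d hd
  have hdR : (0 : ℝ) ≤ d := Nat.cast_nonneg d
  set Ct : ℝ := (126 * 7 ^ d + 648 * 6 ^ d) * d with hCt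
  have hCt0 : 0 ≤ Ct := by positivity
  set C : ℝ := Real.sqrt (192 * 2 ^ d * C₂) + Real.sqrt Ct + Real.sqrt (1161 * 2 ^ d * C₂) with hC
  refine ⟨C, by positivity, ?_⟩
  intro K hK u f a Mu F hMu hF hEq hu hf μ
  have hK3 : (3 : ℝ) ≤ K := by exact_mod_cast hK
  have hK0 : (0 : ℝ) < K := by linarith
  set E : ℝ := ((Mu / K) ^ 2 + (K * F) ^ 2) / K with hE
  have hE0 : 0 ≤ E := by positivity
  set N : ℝ := C₂ * E with hN
  have hN0 : 0 ≤ N := by positivity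
  set P : ℝ := Mu / K + K * F with hP
  have hP0 : 0 ≤ P := by positivity
  have hEP : (Mu / K) ^ 2 + (K * F) ^ 2 ≤ P ^ 2 := by rw [hP]; nlinarith [mul_nonneg (div_nonneg hMu hK0.le) (mul_nonneg hK0.le hF)]
  set v : Zd d → ℝ := fdiff μ u with hv
  have hexc : ∀ x ∈ box a (K : ℤ), ∀ ρ : ℤ, 0 ≤ ρ → ρ ≤ 2 * (K : ℤ) → exc v x ρ ≤ N * ((ρ : ℝ) + 1) ^ (d + 1) := by
    intro x hx ρ h1 h2
    have := hC₂ K hK u f a Mu F hMu hF hEq hu hf x hx μ ρ h1 h2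
    rw [hN, hE]; exact this
  have ha : a ∈ box a (K : ℤ) := self_mem_box a (by positivity)
  constructor
  · -- the sup bound at the centre
    have h1 : (v a - boxAvg v a ((2 * K : ℕ) : ℤ)) ^ 2 ≤ 64 * 2 ^ d * N * (((2 * K : ℕ) : ℝ) + 1) :=
      sq_sub_boxAvg_le_of_campanato v a hN0 (R₀ := 2 * (K : ℤ)) (hexc a ha) (2 * K) (by push_cast; exact le_rfl)
    have h1' : (v a - boxAvg v a ((2 * K : ℕ) : ℤ)) ^ 2 ≤ (192 * 2 ^ d * C₂) * P ^ 2 * 1 := by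
      have hK1 : (((2 * K : ℕ) : ℝ) + 1) ≤ 3 * K := by push_cast; linarith
      have hNE : N * (((2 * K : ℕ) : ℝ) + 1) ≤ C₂ * (3 * P ^ 2) := by
        calc N * (((2 * K : ℕ) : ℝ) + 1) ≤ N * (3 * K) := mul_le_mul_of_nonneg_left hK1 hN0
          _ = C₂ * (3 * ((Mu / K) ^ 2 + (K * F) ^ 2)) := by rw [hN, hE]; field_simp
          _ ≤ C₂ * (3 * P ^ 2) := mul_le_mul_of_nonneg_left (by linarith) hC₂0
      calc (v a - boxAvg v a ((2 * K : ℕ) : ℤ)) ^ 2 ≤ 64 * 2 ^ d * (N * (((2 * K : ℕ) : ℝ) + 1)) := by linarith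
        _ ≤ 64 * 2 ^ d * (C₂ * (3 * P ^ 2)) := mul_le_mul_of_nonneg_left hNE (by positivity)
        _ = (192 * 2 ^ d * C₂) * P ^ 2 * 1 := by ring
    have hi := abs_le_sqrt_mul_of_sq_le (by positivity) hP0 h1'
    rw [Real.sqrt_one, mul_one] at hi
    have hTop := top_scale_bound_zero hd hK u f a hEq hu hf ha
    rw [← hCt, ← hE] at hTop
    have hcard : ((box a (2 * (K : ℤ))).card : ℝ) = ((2 * (2 * (K : ℤ)) + 1 : ℤ) : ℝ) ^ d := card_box a (by positivity)
    have h2 : ((2 * (2 * (K : ℤ)) + 1 : ℤ) : ℝ) ^ d * boxAvg v a (2 * (K : ℤ)) ^ 2 ≤ Ct * ((K : ℝ) ^ (d + 1) * E) := by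
      rw [← hcard]
      calc ((box a (2 * (K : ℤ))).card : ℝ) * boxAvg v a (2 * (K : ℤ)) ^ 2 ≤ ∑ y ∈ box a (2 * (K : ℤ)), v y ^ 2 := card_mul_boxAvg_sq_le v a _
        _ ≤ gradSq u (box a (2 * (K : ℤ))) := sum_sq_fdiff_le_gradSq u _ μ
        _ ≤ _ := hTop
    have h2' : boxAvg v a (2 * (K : ℤ)) ^ 2 ≤ Ct * P ^ 2 * 1 := by
      have hKd : (K : ℝ) ^ d ≤ ((2 * (2 * (K : ℤ)) + 1 : ℤ) : ℝ) ^ d := pow_le_pow_left₀ hK0.le (by push_cast; linarith) d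
      have hcpos : (0 : ℝ) < ((2 * (2 * (K : ℤ)) + 1 : ℤ) : ℝ) ^ d := by apply pow_pos; push_cast; linarith
      have e : Ct * ((K : ℝ) ^ (d + 1) * E) = (K : ℝ) ^ d * (Ct * ((Mu / K) ^ 2 + (K * F) ^ 2)) := by rw [hE]; field_simp; ring
      rw [e] at h2
      have hin : Ct * ((Mu / K) ^ 2 + (K * F) ^ 2) ≤ Ct * P ^ 2 := mul_le_mul_of_nonneg_left hEP hCt0
      have h3 : ((2 * (2 * (K : ℤ)) + 1 : ℤ) : ℝ) ^ d * boxAvg v a (2 * (K : ℤ)) ^ 2 ≤ ((2 * (2 * (K : ℤ)) + 1 : ℤ) : ℝ) ^ d * (Ct * P ^ 2) :=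
        h2.trans (mul_le_mul hKd hin (by positivity) (by positivity))
      have := le_of_mul_le_mul_left h3 hcpos
      linarith
    have hii := abs_le_sqrt_mul_of_sq_le hCt0 hP0 h2'
    rw [Real.sqrt_one, mul_one] at hii
    have hsplit : |v a| ≤ |v a - boxAvg v a ((2 * K : ℕ) : ℤ)| + |boxAvg v a (2 * (K : ℤ))| := by
      have e : v a = (v a - boxAvg v a ((2 * K : ℕ) : ℤ)) + boxAvg v a (2 * (K : ℤ)) := by push_cast; ring
      conv_lhs => rw [e]
      exact abs_add_le _ _
    have hC3 : 0 ≤ Real.sqrt (1161 * 2 ^ d * C₂) * P := by positivity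
    calc |v a| ≤ Real.sqrt (192 * 2 ^ d * C₂) * P + Real.sqrt Ct * P := hsplit.trans (add_le_add hi hii)
      _ ≤ C * P := by rw [hC]; nlinarith
  · -- the Hölder modulus
    intro x' ρ₀ hρ₀ hρ₀K hx'
    have hx'K : x' ∈ box a (K : ℤ) := box_mono a (by exact_mod_cast hρ₀K) hx'
    have hsq := sq_sub_le_of_campanato v hx' hN0 (R₀ := 2 * (K : ℤ)) (by linarith) (hexc a ha) (hexc x' hx'K)
    have hρ₀R : (1 : ℝ) ≤ ρ₀ := by exact_mod_cast hρ₀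
    have hsq' : (v x' - v a) ^ 2 ≤ (1161 * 2 ^ d * C₂) * P ^ 2 * ((ρ₀ : ℝ) / K) := by
      have hNE : N * (2 * (ρ₀ : ℝ) + 1) ≤ C₂ * P ^ 2 * (3 * ((ρ₀ : ℝ) / K)) := by
        calc N * (2 * (ρ₀ : ℝ) + 1) ≤ N * (3 * ρ₀) := mul_le_mul_of_nonneg_left (by linarith) hN0
          _ = C₂ * ((Mu / K) ^ 2 + (K * F) ^ 2) * (3 * ((ρ₀ : ℝ) / K)) := by rw [hN, hE]; field_simp
          _ ≤ C₂ * P ^ 2 * (3 * ((ρ₀ : ℝ) / K)) := by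
              apply mul_le_mul_of_nonneg_right (mul_le_mul_of_nonneg_left hEP hC₂0) (by positivity)
      calc (v x' - v a) ^ 2 ≤ 387 * 2 ^ d * (N * (2 * (ρ₀ : ℝ) + 1)) := by linarith
        _ ≤ 387 * 2 ^ d * (C₂ * P ^ 2 * (3 * ((ρ₀ : ℝ) / K))) := mul_le_mul_of_nonneg_left hNE (by positivity)
        _ = (1161 * 2 ^ d * C₂) * P ^ 2 * ((ρ₀ : ℝ) / K) := by ring
    have h := abs_le_sqrt_mul_of_sq_le (by positivity) hP0 hsq'
    calc |v x' - v a| ≤ Real.sqrt (1161 * 2 ^ d * C₂) * P * Real.sqrt ((ρ₀ : ℝ) / K) := h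
      _ ≤ C * P * Real.sqrt ((ρ₀ : ℝ) / K) := by
          apply mul_le_mul_of_nonneg_right _ (Real.sqrt_nonneg _)
          apply mul_le_mul_of_nonneg_right _ hP0
          rw [hC]; have := Real.sqrt_nonneg (192 * 2 ^ d * C₂); have := Real.sqrt_nonneg Ct; linarith

end Summit.QuantumFields.YangMills.Theorems.Prop7FlatInteriorGradient

end
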